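import Summits.CriticalPhenomena.PercolationContinuityZ3.Theorems.PercNearOneGluingNoHeavyLowerTailChampionStability
import Literature.Probability.Percolation.PassengerLonelyExchange
import HarnessLib

/-!
# `NoHeavyLowerTail` (stmt-CriticalPhenomena-4575) — pattern-lightest bound for relay-neighboured observers, part 1:
# gluing the observer onto a port costs that port at least as much lightness as it costs any passenger

Support file (prover `prim-hp-8`, technique "tie/glue-locus exclusion"; `--supports stmt-CriticalPhenomena-4575`).
No definitions, no named facts, no sorries.

Setting: `μ = prodBernoulli v`, relays `A`, level `j`, an observer `o`, a vertex `p ≠ o` with `v s(o,p) = 0`, any vertex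
`x`; `R_a = {|π(a)| ≤ j}` (`π(a) = A.filter (a ↔ ·)`), `D = {o ↮ p}`, `v⁺ = v[s(o,p) ↦ 1]` (the observer glued onto `p`).
The LOSS of `a` is `μ_v(R_a) − μ_{v⁺}(R_a)`.

* `selfGluingLoss_ge`: if `μ(D ∩ R_o) ≤ μ(D ∩ R_p)` then `loss(x) ≤ loss(p)`.  After gluing, `π(p)` becomes `π(p) ∪ π(o)`
  and `π(x)` becomes `π(x) ∪ π(o) ∪ π(p)` when `x` is joined to `o` or `p` (`ChampionStability.reachable_insert_iff`); the
  two losses agree on `{x ↔ p}` and on `{both blocks light}`; what remains is `passengerLonelyTransfer` (BHK 2006 Thm 1.5)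
  with `s = o`, `t = p` and passenger `x`.
Parts 2–3: `…PatternLightestStarGlue` (the hypothesis from `observerSet_le_of_lonelier`, and the loss comparison for a
relay-neighboured observer with arbitrary weights at `o`), `…PatternLightestStar` (the bound itself).  Memo: PROOF-PL-STAR.md
on the item.
-/

noncomputable section

namespace Summit.CriticalPhenomena.PercolationContinuityZ3.Theorems

namespace PatternLightestStar

open MeasureTheory Set Literature.Probability.LatticeModels Literature.Probability.Percolation
open scoped Classical

variable {n : ℕ}

/-- Relay block of `p` after opening `s(o,p)`: `π'(p) = π(p) ∪ π(o)`. [folklore] -/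
theorem filter_insert_self (ω : BondConfig (Fin n)) (A : Finset (Fin n)) {o p : Fin n} (hop : o ≠ p) :
    (A.filter fun z => insert s(o, p) ω ∈ openConn p z) =
      (A.filter fun z => ω ∈ openConn p z) ∪ (A.filter fun z => ω ∈ openConn o z) := by
  ext z
  simp only [Finset.mem_filter, Finset.mem_union]
  have key : (openGraph (insert s(o, p) ω)).Reachable p z ↔
      ((openGraph ω).Reachable p z ∨ (openGraph ω).Reachable o z) := by
    have h := ChampionStability.reachable_insert_left_iff ω (Ne.symm hop) z
    rw [Sym2.eq_swap] at h
    exact h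
  change z ∈ A ∧ (openGraph (insert s(o, p) ω)).Reachable p z ↔
    (z ∈ A ∧ (openGraph ω).Reachable p z) ∨ (z ∈ A ∧ (openGraph ω).Reachable o z)
  rw [key]
  tauto

/-- Relay block of a passenger `x` after opening `s(o,p)`: unchanged unless `x` is joined to `o` or `p`, in which case it is
`π(x) ∪ π(o) ∪ π(p)`; stated as the two inclusions we need. [folklore] -/
theorem filter_insert_passenger_of_not (ω : BondConfig (Fin n)) (A : Finset (Fin n)) {o p x : Fin n} (hop : o ≠ p)
    (hxo : ¬ (openGraph ω).Reachable x o) (hxp : ¬ (openGraph ω).Reachable x p) :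
    (A.filter fun z => insert s(o, p) ω ∈ openConn x z) = A.filter fun z => ω ∈ openConn x z := by
  ext z
  simp only [Finset.mem_filter]
  have := ChampionStability.reachable_insert_iff_of_not ω hop hxo hxp z
  change z ∈ A ∧ (openGraph (insert s(o, p) ω)).Reachable x z ↔ z ∈ A ∧ (openGraph ω).Reachable x z
  rw [this]

/-- After opening `s(o,p)`, the relay block of any `x` lies inside `π(x) ∪ π(p) ∪ π(o)`. [folklore] -/
theorem filter_insert_passenger_subset (ω : BondConfig (Fin n)) (A : Finset (Fin n)) {o p : Fin n} (x : Fin n)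
    (hop : o ≠ p) :
    (A.filter fun z => insert s(o, p) ω ∈ openConn x z) ⊆
      (A.filter fun z => ω ∈ openConn x z) ∪
        ((A.filter fun z => ω ∈ openConn p z) ∪ (A.filter fun z => ω ∈ openConn o z)) := by
  intro z hz
  simp only [Finset.mem_filter, Finset.mem_union] at hz ⊢
  obtain ⟨hzA, hr⟩ := hz
  have hr' : (openGraph (insert s(o, p) ω)).Reachable x z := hr
  rw [ChampionStability.reachable_insert_iff ω hop] at hr'
  rcases hr' with h | ⟨-, ⟨s, hs, hsz⟩⟩
  · exact Or.inl ⟨hzA, h⟩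
  · simp only [Finset.mem_insert, Finset.mem_singleton] at hs
    rcases hs with rfl | rfl
    · exact Or.inr (Or.inr ⟨hzA, hsz⟩)
    · exact Or.inr (Or.inl ⟨hzA, hsz⟩)

/-- **Self-gluing loss domination (step (TOP') of PL for relay-neighboured observers).**  See the module docstring.
[cite: VandenbergHaggstromKahn2005, Thm. 1.5 — via `passengerLonelyTransfer`] -/
theorem selfGluingLoss_ge (v : Sym2 (Fin n) → unitInterval) (A : Finset (Fin n)) (j : ℕ) {o p : Fin n} (hop : o ≠ p)
    (hv : v s(o, p) = 0) (x : Fin n)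
    (hyp : (prodBernoulli v).real ((openConn o p)ᶜ ∩
        {ω : BondConfig (Fin n) | (A.filter fun z => ω ∈ openConn o z).card ≤ j}) ≤
      (prodBernoulli v).real ((openConn o p)ᶜ ∩
        {ω : BondConfig (Fin n) | (A.filter fun z => ω ∈ openConn p z).card ≤ j})) :
    (prodBernoulli v).real {ω : BondConfig (Fin n) | (A.filter fun z => ω ∈ openConn x z).card ≤ j} -
        (prodBernoulli (Function.update v s(o, p) 1)).real
          {ω : BondConfig (Fin n) | (A.filter fun z => ω ∈ openConn x z).card ≤ j} ≤
      (prodBernoulli v).real {ω : BondConfig (Fin n) | (A.filter fun z => ω ∈ openConn p z).card ≤ j} -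
        (prodBernoulli (Function.update v s(o, p) 1)).real
          {ω : BondConfig (Fin n) | (A.filter fun z => ω ∈ openConn p z).card ≤ j} := by
  set μ := prodBernoulli v with hμ
  -- blocks and events
  set Bp : BondConfig (Fin n) → Finset (Fin n) := fun ω => A.filter fun z => ω ∈ openConn p z with hBp
  set Bo : BondConfig (Fin n) → Finset (Fin n) := fun ω => A.filter fun z => ω ∈ openConn o z with hBo
  set Bx : BondConfig (Fin n) → Finset (Fin n) := fun ω => A.filter fun z => ω ∈ openConn x z with hBx
  set Rp : Set (BondConfig (Fin n)) := {ω | (Bp ω).card ≤ j} with hRp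
  set Ro : Set (BondConfig (Fin n)) := {ω | (Bo ω).card ≤ j} with hRo
  set Rx : Set (BondConfig (Fin n)) := {ω | (Bx ω).card ≤ j} with hRx
  set D : Set (BondConfig (Fin n)) := (openConn o p)ᶜ with hD
  set E : Set (BondConfig (Fin n)) := openConn o x with hE
  set Rp' : Set (BondConfig (Fin n)) := {ω | (Bp ω ∪ Bo ω).card ≤ j} with hRp'
  set K1 : Set (BondConfig (Fin n)) := Rp ∩ Rp'ᶜ with hK1
  set K3 : Set (BondConfig (Fin n)) := Ro ∩ Rp'ᶜ with hK3
  set Xp : Set (BondConfig (Fin n)) := openConn x p with hXp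
  set Xo : Set (BondConfig (Fin n)) := openConn x o with hXo
  have hmeas : ∀ S : Set (BondConfig (Fin n)), MeasurableSet S := fun S => (Set.toFinite S).measurableSet
  have hfin : ∀ S : Set (BondConfig (Fin n)), μ S ≠ ⊤ := fun S => measure_ne_top _ _
  -- the glued measure as a preimage
  have hglue : ∀ S : Set (BondConfig (Fin n)), (prodBernoulli (Function.update v s(o, p) 1)).real S =
      μ.real ((fun ω : BondConfig (Fin n) => insert s(o, p) ω) ⁻¹' S) :=
    fun S => ChampionStability.real_update_one_eq v hv S
  -- (1) the loss of p is exactly μ(K1)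
  have hpre_p : (fun ω : BondConfig (Fin n) => insert s(o, p) ω) ⁻¹'
      {ω : BondConfig (Fin n) | (A.filter fun z => ω ∈ openConn p z).card ≤ j} = Rp' := by
    ext ω
    simp only [mem_preimage, mem_setOf_eq, hRp']
    rw [filter_insert_self ω A hop]
  have hRp'sub : Rp' ⊆ Rp := by
    intro ω hω
    simp only [hRp', hRp, mem_setOf_eq] at hω ⊢
    exact le_trans (Finset.card_le_card Finset.subset_union_left) hω
  have hkap : μ.real {ω : BondConfig (Fin n) | (A.filter fun z => ω ∈ openConn p z).card ≤ j} -
      (prodBernoulli (Function.update v s(o, p) 1)).real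
        {ω : BondConfig (Fin n) | (A.filter fun z => ω ∈ openConn p z).card ≤ j} = μ.real K1 := by
    rw [hglue, hpre_p]
    change μ.real Rp - μ.real Rp' = μ.real (Rp ∩ Rp'ᶜ)
    have h := measureReal_inter_add_sdiff (μ := μ) (s := Rp) (hmeas Rp')
    rw [inter_eq_right.2 hRp'sub] at h
    rw [← h, Set.sdiff_eq]
    ring
  -- (2) the loss of x is at most μ(K1 ∩ Xp) + μ(K3 ∩ Xo ∩ Xpᶜ)
  have hsubx : {ω : BondConfig (Fin n) | (A.filter fun z => ω ∈ openConn x z).card ≤ j} ⊆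
      (fun ω : BondConfig (Fin n) => insert s(o, p) ω) ⁻¹'
          {ω : BondConfig (Fin n) | (A.filter fun z => ω ∈ openConn x z).card ≤ j} ∪
        ((K1 ∩ Xp) ∪ (K3 ∩ Xo ∩ Xpᶜ)) := by
    intro ω hω
    simp only [mem_setOf_eq] at hω
    by_cases hxp : (openGraph ω).Reachable x p
    · -- x joined to p: blocks of x and p coincide
      by_cases hlight : (Bp ω ∪ Bo ω).card ≤ j
      · left
        simp only [mem_preimage, mem_setOf_eq]
        refine le_trans (Finset.card_le_card ((filter_insert_passenger_subset ω A x hop).trans ?_)) hlight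
        intro z hz
        simp only [Finset.mem_union] at hz ⊢
        rcases hz with h | h | h
        · left
          simp only [hBp, Finset.mem_filter] at h ⊢
          exact ⟨h.1, (hxp.symm.trans h.2 : (openGraph ω).Reachable p z)⟩
        · exact Or.inl h
        · exact Or.inr h
      · right; left
        refine ⟨⟨?_, hlight⟩, hxp⟩
        simp only [hRp, mem_setOf_eq]
        have : Bp ω = Bx ω := by
          simp only [hBp, hBx]
          apply Finset.filter_congr
          intro z _
          exact ⟨fun h => (hxp.trans h : (openGraph ω).Reachable x z),
            fun h => (hxp.symm.trans h : (openGraph ω).Reachable p z)⟩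
        rw [this]; exact hω
    · by_cases hxo : (openGraph ω).Reachable x o
      · by_cases hlight : (Bp ω ∪ Bo ω).card ≤ j
        · left
          simp only [mem_preimage, mem_setOf_eq]
          refine le_trans (Finset.card_le_card ((filter_insert_passenger_subset ω A x hop).trans ?_)) hlight
          intro z hz
          simp only [Finset.mem_union] at hz ⊢
          rcases hz with h | h | h
          · right
            simp only [hBo, Finset.mem_filter] at h ⊢
            exact ⟨h.1, (hxo.symm.trans h.2 : (openGraph ω).Reachable o z)⟩
          · exact Or.inl h
          · exact Or.inr h
        · right; right
          refine ⟨⟨⟨?_, hlight⟩, hxo⟩, hxp⟩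
          simp only [hRo, mem_setOf_eq]
          have : Bo ω = Bx ω := by
            simp only [hBo, hBx]
            apply Finset.filter_congr
            intro z _
            exact ⟨fun h => (hxo.trans h : (openGraph ω).Reachable x z),
              fun h => (hxo.symm.trans h : (openGraph ω).Reachable o z)⟩
          rw [this]; exact hω
      · left
        simp only [mem_preimage, mem_setOf_eq]
        rw [filter_insert_passenger_of_not ω A hop hxo hxp]
        exact hω
  have hlam : μ.real {ω : BondConfig (Fin n) | (A.filter fun z => ω ∈ openConn x z).card ≤ j} -
      (prodBernoulli (Function.update v s(o, p) 1)).real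
        {ω : BondConfig (Fin n) | (A.filter fun z => ω ∈ openConn x z).card ≤ j} ≤
      μ.real (K1 ∩ Xp) + μ.real (K3 ∩ Xo ∩ Xpᶜ) := by
    rw [hglue]
    have h1 := measureReal_mono (μ := μ) hsubx (hfin _)
    have h2 := measureReal_union_le (μ := μ)
      ((fun ω : BondConfig (Fin n) => insert s(o, p) ω) ⁻¹'
          {ω : BondConfig (Fin n) | (A.filter fun z => ω ∈ openConn x z).card ≤ j})
      ((K1 ∩ Xp) ∪ (K3 ∩ Xo ∩ Xpᶜ))
    have h3 := measureReal_union_le (μ := μ) (K1 ∩ Xp) (K3 ∩ Xo ∩ Xpᶜ)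
    linarith
  -- (3) μ(K1) = μ(K1 ∩ Xp) + μ(K1 ∩ Xpᶜ)
  have hK1split : μ.real K1 = μ.real (K1 ∩ Xp) + μ.real (K1 ∩ Xpᶜ) := by
    rw [← measureReal_inter_add_sdiff (μ := μ) (s := K1) (hmeas Xp), Set.sdiff_eq]
  -- (4) split the remaining terms along Ro / Rp
  have hK1' : μ.real (K1 ∩ Xpᶜ) = μ.real (K1 ∩ Xpᶜ ∩ Ro) + μ.real (K1 ∩ Xpᶜ ∩ Roᶜ) := by
    rw [← measureReal_inter_add_sdiff (μ := μ) (s := K1 ∩ Xpᶜ) (hmeas Ro), Set.sdiff_eq]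
  have hK3' : μ.real (K3 ∩ Xo ∩ Xpᶜ) = μ.real (K3 ∩ Xo ∩ Xpᶜ ∩ Rp) + μ.real (K3 ∩ Xo ∩ Xpᶜ ∩ Rpᶜ) := by
    rw [← measureReal_inter_add_sdiff (μ := μ) (s := K3 ∩ Xo ∩ Xpᶜ) (hmeas Rp), Set.sdiff_eq]
  -- (4a) both-light parts: K3 ∩ Xo ∩ Xpᶜ ∩ Rp ⊆ K1 ∩ Xpᶜ ∩ Ro
  have h4a : μ.real (K3 ∩ Xo ∩ Xpᶜ ∩ Rp) ≤ μ.real (K1 ∩ Xpᶜ ∩ Ro) := by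
    apply measureReal_mono _ (hfin _)
    rintro ω ⟨⟨⟨⟨hRo', hRp'c⟩, _⟩, hxp⟩, hRpω⟩
    exact ⟨⟨⟨hRpω, hRp'c⟩, hxp⟩, hRo'⟩
  -- (4b) the exchange part: K3 ∩ Xo ∩ Xpᶜ ∩ Rpᶜ ⊆ D ∩ (Ro ∩ Rpᶜ ∩ E) and D ∩ (Rp ∩ Roᶜ ∩ E) ⊆ K1 ∩ Xpᶜ ∩ Roᶜ
  have hDof : ∀ ω : BondConfig (Fin n), ω ∉ Rp' → ω ∈ Ro → ω ∈ D := by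
    intro ω h1 h2 hop'
    apply h1
    simp only [hRp', mem_setOf_eq]
    have hsub : Bp ω ∪ Bo ω ⊆ Bo ω := by
      intro z hz
      simp only [Finset.mem_union] at hz
      rcases hz with h | h
      · simp only [hBp, hBo, Finset.mem_filter] at h ⊢
        have hop'' : (openGraph ω).Reachable o p := hop'
        exact ⟨h.1, (hop''.trans h.2 : (openGraph ω).Reachable o z)⟩
      · exact h
    exact le_trans (Finset.card_le_card hsub) h2
  have hDof' : ∀ ω : BondConfig (Fin n), ω ∉ Rp' → ω ∈ Rp → ω ∈ D := by
    intro ω h1 h2 hop'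
    apply h1
    simp only [hRp', mem_setOf_eq]
    have hsub : Bp ω ∪ Bo ω ⊆ Bp ω := by
      intro z hz
      simp only [Finset.mem_union] at hz
      rcases hz with h | h
      · exact h
      · simp only [hBp, hBo, Finset.mem_filter] at h ⊢
        have hop'' : (openGraph ω).Reachable o p := hop'
        exact ⟨h.1, (hop''.symm.trans h.2 : (openGraph ω).Reachable p z)⟩
    exact le_trans (Finset.card_le_card hsub) h2
  have h4b1 : μ.real (K3 ∩ Xo ∩ Xpᶜ ∩ Rpᶜ) ≤ μ.real (D ∩ (Ro ∩ Rpᶜ ∩ E)) := by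
    apply measureReal_mono _ (hfin _)
    rintro ω ⟨⟨⟨⟨hRo', hRp'c⟩, hxo⟩, _⟩, hRpc⟩
    refine ⟨hDof ω hRp'c hRo', ⟨hRo', hRpc⟩, ?_⟩
    have hxo' : (openGraph ω).Reachable x o := hxo
    exact (hxo'.symm : (openGraph ω).Reachable o x)
  have h4b3 : μ.real (D ∩ (Rp ∩ Roᶜ ∩ E)) ≤ μ.real (K1 ∩ Xpᶜ ∩ Roᶜ) := by
    apply measureReal_mono _ (hfin _)
    rintro ω ⟨hDω, ⟨hRpω, hRoc⟩, hE'⟩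
    have hRp'c : ω ∉ Rp' := by
      intro h'
      apply hRoc
      simp only [hRp', hRo, mem_setOf_eq] at h' ⊢
      exact le_trans (Finset.card_le_card Finset.subset_union_right) h'
    refine ⟨⟨⟨hRpω, hRp'c⟩, ?_⟩, hRoc⟩
    intro hxp
    apply hDω
    have hE'' : (openGraph ω).Reachable o x := hE'
    have hxp' : (openGraph ω).Reachable x p := hxp
    exact (hE''.trans hxp' : (openGraph ω).Reachable o p)
  -- the passenger lonely transfer
  have hpass := passengerLonelyTransfer v A j hop x hyp
  -- assemble
  have hkap' := hkap
  rw [hkap]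
  calc μ.real {ω : BondConfig (Fin n) | (A.filter fun z => ω ∈ openConn x z).card ≤ j} -
        (prodBernoulli (Function.update v s(o, p) 1)).real
          {ω : BondConfig (Fin n) | (A.filter fun z => ω ∈ openConn x z).card ≤ j}
      ≤ μ.real (K1 ∩ Xp) + μ.real (K3 ∩ Xo ∩ Xpᶜ) := hlam
    _ = μ.real (K1 ∩ Xp) + (μ.real (K3 ∩ Xo ∩ Xpᶜ ∩ Rp) + μ.real (K3 ∩ Xo ∩ Xpᶜ ∩ Rpᶜ)) := by rw [hK3']
    _ ≤ μ.real (K1 ∩ Xp) + (μ.real (K1 ∩ Xpᶜ ∩ Ro) + μ.real (D ∩ (Ro ∩ Rpᶜ ∩ E))) := by linarith [h4a, h4b1]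
    _ ≤ μ.real (K1 ∩ Xp) + (μ.real (K1 ∩ Xpᶜ ∩ Ro) + μ.real (D ∩ (Rp ∩ Roᶜ ∩ E))) := by linarith [hpass]
    _ ≤ μ.real (K1 ∩ Xp) + (μ.real (K1 ∩ Xpᶜ ∩ Ro) + μ.real (K1 ∩ Xpᶜ ∩ Roᶜ)) := by linarith [h4b3]
    _ = μ.real K1 := by rw [← hK1', ← hK1split]

end PatternLightestStar

end Summit.CriticalPhenomena.PercolationContinuityZ3.Theorems

end
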